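import Literature.Analysis.FluidPDE.DuchonRobertLionsEnergyEquality
import HarnessLib

/-!
# Weak Navier–Stokes solutions in the energy class on `T^d`: slice bookkeeping

Analysis/FluidPDE support file (theorem-only). The tree's time-sliced weak formulation and the
measurability / integrability bookkeeping of the slice functionals of a weak solution
(`Literature/Analysis/FluidPDE/LerayHopfTimeSliceTorus`, `LerayHopfSpectralMeasurability`,
`DuchonRobertLionsEnergyEquality`) are keyed on the accepted structure `Torus.IsLerayHopfOn`,
although their proofs never use its two energy inequalities. This file re-derives them for a
forced weak solution `u` of the Navier–Stokes system on `T^d × [0, T)` in the **energy class**,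
given by the unbundled hypotheses

* `hw  : Torus.IsWeakNSSolutionForcedOn T ν f u₀ u` (the Leray space–time formulation),
* `hE  : u ∈ L^∞(0,T; L²)` (an a.e. bound `∫⁻ ‖u(t)‖ₑ² ≤ C`),
* `hL2 : u(t) ∈ L²` for every `t ∈ [0, T]`,
* `hH1 : u ∈ L²(0,T; H¹)` spectrally (`Torus.MemL2Sobolev 0 T 1`),
* `hwc : ` weak `L²`-continuity on `(0, T]` with weak limit `u₀` at `0⁺`,

i.e. every clause of `Torus.IsLerayHopfOn` except `energy_ineq_zero`, `energy_ineq_ae` and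
`strong_initial`. It is the first of three files proving that in two space dimensions such a
solution satisfies the energy **equality** and is therefore a Leray–Hopf solution (Lions–Prodi
1959; Temam 1984, Ch. III, Thm. 3.2; Foias–Manley–Rosa–Temam 2001, Ch. II, Thm. 7.3), by the
Galerkin/Fourier-truncation form of the Lions–Shinbrot argument already formalised for
Leray–Hopf solutions in `DuchonRobertLionsEnergyEquality` (`lions_energy_equality_Ioc`).

Contents (namespace `Literature.Analysis.FluidPDE.Torus.WeakNSEnergyClass`, proofs verbatim
those of the Leray–Hopf-keyed twins): joint measurability, measurability and integrability of
`s ↦ ⟨u(s), a⟩` and of the flux `s ↦ ∫(⟪u,(u·∇)Ψ⟫ + ν⟪u,ΔΨ⟫ + ⟪f,Ψ⟫)` for an `L¹(0,T;L²)`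
force, weak divergence-freeness at every `t ∈ (0, T]` and of the datum, the time-sliced identity
`⟨u(t),Ψ⟩ = ⟨u₀,Ψ⟩ + ∫_{(0,t]} Φ[u;Ψ]` for every `t ∈ (0,T]`, time-measurability of the slice
Fourier coefficients and of the spectral dissipation (the finiteness `∫₀ᵀ ‖∇u‖₂² < ∞` is the
tree's `Torus.lintegral_eGradNormSq_lt_top_of_memL2Sobolev`).

## References

* R. Temam, *Navier–Stokes Equations*, 3rd ed., North-Holland 1984, Ch. III §1.1, (1.22)–(1.25),
  Lemma 1.1; Thm. 3.2.
* J.-L. Lions, G. Prodi, C. R. Acad. Sci. Paris 248 (1959), 3519–3521.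
* C. Foias, O. Manley, R. Rosa, R. Temam, *Navier–Stokes Equations and Turbulence*, CUP 2001,
  Ch. II, Thm. 7.3.
-/

noncomputable section

open MeasureTheory TopologicalSpace Set Function Filter Topology UnitAddTorus
open scoped InnerProductSpace RealInnerProductSpace ENNReal NNReal ContDiff

namespace Literature.Analysis.FluidPDE

namespace Torus

namespace WeakNSEnergyClass

variable {d : Type*} [Fintype d] [DecidableEq d]

variable {T ν : ℝ} {f u : ℝ → UnitAddTorus d → EuclideanSpace ℝ d}
  {u₀ : UnitAddTorus d → EuclideanSpace ℝ d}

/-! ### Measurability of the slice functionals -/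

/-- Joint measurability of a weak solution on `(0,T) × T^d` for the product measure. [folklore] -/
theorem aestronglyMeasurable_uncurry (hw : IsWeakNSSolutionForcedOn T ν f u₀ u) :
    AEStronglyMeasurable (uncurry u) ((volume.restrict (Ioo 0 T)).prod volume) := by
  have h := FunctionSpaces.Torus.aestronglyMeasurable_uncurry_of_stLift_restrict hw.1
  rwa [Measure.volume_eq_prod, ← Measure.prod_restrict, Measure.restrict_univ] at h

/-- The pairing `s ↦ ⟨u(s), a⟩` of a weak solution with a continuous field is a.e.-strongly
measurable on `(0, T)` (Fubini). [folklore] -/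
theorem aestronglyMeasurable_integral_inner (hw : IsWeakNSSolutionForcedOn T ν f u₀ u)
    {a : UnitAddTorus d → EuclideanSpace ℝ d} (ha : Continuous a) :
    AEStronglyMeasurable (fun s => ∫ x, ⟪u s x, a x⟫) (volume.restrict (Ioo 0 T)) := by
  have h1 : AEStronglyMeasurable (fun p : ℝ × UnitAddTorus d => ⟪uncurry u p, a p.2⟫)
      ((volume.restrict (Ioo 0 T)).prod volume) :=
    (aestronglyMeasurable_uncurry hw).inner (ha.comp continuous_snd).aestronglyMeasurable
  exact h1.integral_prod_right'

/-- The flux `s ↦ ∫ (⟪u, (u·∇)Ψ⟫ + ν⟪u, ΔΨ⟫ + ⟪f, Ψ⟫)` of a weak solution against a smooth field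
is a.e.-strongly measurable on `(0, T)`. [folklore] -/
theorem aestronglyMeasurable_flux (hw : IsWeakNSSolutionForcedOn T ν f u₀ u)
    (hfm : AEStronglyMeasurable (FunctionSpaces.Torus.stLift f) (volume.restrict (Ioo 0 T ×ˢ univ)))
    {Ψ : UnitAddTorus d → EuclideanSpace ℝ d} (hΨ : FunctionSpaces.Torus.IsSmooth Ψ) :
    AEStronglyMeasurable
      (fun s => ∫ x, (⟪u s x, FunctionSpaces.Torus.convect (u s) Ψ x⟫ + ν * ⟪u s x, FunctionSpaces.Torus.laplacian Ψ x⟫ + ⟪f s x, Ψ x⟫))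
      (volume.restrict (Ioo 0 T)) := by
  have hu' := aestronglyMeasurable_uncurry hw
  have hf' : AEStronglyMeasurable (uncurry f) ((volume.restrict (Ioo 0 T)).prod volume) := by
    have h := FunctionSpaces.Torus.aestronglyMeasurable_uncurry_of_stLift_restrict hfm
    rwa [Measure.volume_eq_prod, ← Measure.prod_restrict, Measure.restrict_univ] at h
  -- the convective term as a finite sum `∑ᵢ uᵢ ∂ᵢΨ`
  have hconv : (fun p : ℝ × UnitAddTorus d => FunctionSpaces.Torus.convect (u p.1) Ψ p.2) =
      fun p => ∑ i, (uncurry u p) i • FunctionSpaces.Torus.partialDeriv i Ψ p.2 := by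
    funext p
    exact FunctionSpaces.Torus.fderiv_apply_eq_sum_partialDeriv (hΨ.isContDiff (by simp)) _ _
  have hconvm : AEStronglyMeasurable (fun p : ℝ × UnitAddTorus d => FunctionSpaces.Torus.convect (u p.1) Ψ p.2)
      ((volume.restrict (Ioo 0 T)).prod volume) := by
    rw [hconv]
    exact Finset.aestronglyMeasurable_fun_sum _ fun i _ =>
      ((EuclideanSpace.proj (𝕜 := ℝ) i).continuous.comp_aestronglyMeasurable hu').smul
        ((hΨ.partialDeriv i).continuous.comp continuous_snd).aestronglyMeasurable
  have hL : AEStronglyMeasurable (fun p : ℝ × UnitAddTorus d => FunctionSpaces.Torus.laplacian Ψ p.2)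
      ((volume.restrict (Ioo 0 T)).prod volume) :=
    (hΨ.laplacian.continuous.comp continuous_snd).aestronglyMeasurable
  have hP : AEStronglyMeasurable (fun p : ℝ × UnitAddTorus d => Ψ p.2)
      ((volume.restrict (Ioo 0 T)).prod volume) :=
    (hΨ.continuous.comp continuous_snd).aestronglyMeasurable
  have h1 : AEStronglyMeasurable (fun p : ℝ × UnitAddTorus d =>
      ⟪uncurry u p, FunctionSpaces.Torus.convect (u p.1) Ψ p.2⟫ + ν * ⟪uncurry u p, FunctionSpaces.Torus.laplacian Ψ p.2⟫ +
        ⟪uncurry f p, Ψ p.2⟫) ((volume.restrict (Ioo 0 T)).prod volume) :=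
    ((hu'.inner hconvm).add ((hu'.inner hL).const_mul ν)).add (hf'.inner hP)
  exact h1.integral_prod_right'

/-- Time-measurability of `s ↦ ∫⁻ ‖u(s)‖ₑ^p` for a weak solution (Tonelli). [folklore] -/
theorem aemeasurable_lintegral_enorm_pow (hw : IsWeakNSSolutionForcedOn T ν f u₀ u) (p : ℕ) :
    AEMeasurable (fun s => ∫⁻ x, ‖u s x‖ₑ ^ p) (volume.restrict (Ioo 0 T)) :=
  ((aestronglyMeasurable_uncurry hw).aemeasurable.enorm.pow_const p).lintegral_prod_right'

/-- Time-measurability of the spatial Fourier coefficients of a weak solution (Fubini). [folklore] -/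
theorem aestronglyMeasurable_mFourierCoeff_complexify (hw : IsWeakNSSolutionForcedOn T ν f u₀ u)
    (k : d → ℤ) :
    AEStronglyMeasurable (fun s => mFourierCoeff (FunctionSpaces.EuclideanSpace.complexify ∘ u s) k)
      (volume.restrict (Ioo 0 T)) := by
  have hF := aestronglyMeasurable_uncurry hw
  have hG : AEStronglyMeasurable (fun p : ℝ × UnitAddTorus d =>
      mFourier (-k) p.2 • FunctionSpaces.EuclideanSpace.complexify (uncurry u p))
      ((volume.restrict (Ioo 0 T)).prod volume) :=
    ((mFourier (-k)).continuous.comp continuous_snd).aestronglyMeasurable.smul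
      (FunctionSpaces.EuclideanSpace.continuous_complexify.comp_aestronglyMeasurable hF)
  refine hG.integral_prod_right'.congr (ae_of_all _ fun t => ?_)
  simp only [FunctionSpaces.Torus.mFourierCoeff_eq_integral_volume, comp_apply, uncurry_apply_pair]

/-- Along a weak solution with `L²` slices, `t ↦ ‖𝓕(complexify ∘ u(t))(k)‖²` is
a.e.-measurable on `(0, T)`. [folklore] -/
theorem aemeasurable_enorm_sq_mFourierCoeff (hw : IsWeakNSSolutionForcedOn T ν f u₀ u)
    (hL2 : ∀ t ∈ Icc 0 T, MemLp (u t) 2 volume) (k : d → ℤ) :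
    AEMeasurable (fun t => ‖mFourierCoeff (FunctionSpaces.EuclideanSpace.complexify ∘ u t) k‖ₑ ^ 2)
      (volume.restrict (Ioo 0 T)) := by
  have hcomp : ∀ i : d, AEMeasurable (fun t => ‖mFourierCoeff (fun x => (u t x i : ℂ)) k‖ₑ ^ 2)
      (volume.restrict (Ioo 0 T)) := fun i =>
    (aestronglyMeasurable_mFourierCoeff_slice (aestronglyMeasurable_uncurry hw) i k).enorm.pow_const 2
  refine (Finset.aemeasurable_sum Finset.univ fun i _ => hcomp i).congr ?_
  filter_upwards [ae_restrict_mem measurableSet_Ioo] with t ht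
  rw [Finset.sum_apply]
  exact (enorm_sq_mFourierCoeff_complexify_eq_sum
    ((hL2 t (Ioo_subset_Icc_self ht)).integrable one_le_two) k).symm

/-- Along a weak solution with `L²` slices, the spectral dissipation `t ↦ ‖∇u(t)‖₂²`
(`Torus.eGradNormSq`) is a.e.-measurable on `(0, T)`. [folklore] -/
theorem aemeasurable_eGradNormSq (hw : IsWeakNSSolutionForcedOn T ν f u₀ u)
    (hL2 : ∀ t ∈ Icc 0 T, MemLp (u t) 2 volume) :
    AEMeasurable (fun t => FunctionSpaces.Torus.eGradNormSq (u t)) (volume.restrict (Ioo 0 T)) := by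
  have h : (fun t => FunctionSpaces.Torus.eGradNormSq (u t)) = fun t =>
      ENNReal.ofReal (4 * Real.pi ^ 2) * ∑' k : d → ℤ, ENNReal.ofReal (FunctionSpaces.Torus.freqNormSq k) *
        ‖mFourierCoeff (FunctionSpaces.EuclideanSpace.complexify ∘ u t) k‖ₑ ^ 2 := by
    funext t; exact FunctionSpaces.Torus.eGradNormSq_eq_tsum (u t)
  rw [h]
  exact (AEMeasurable.tsum fun k =>
    (aemeasurable_enorm_sq_mFourierCoeff hw hL2 k).const_mul _).const_mul _

/-! ### Energy bounds and integrability of the slice functionals -/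

omit [DecidableEq d] in
/-- **A.e. energy bound in real form**: `∫ ‖u(s)‖² ≤ C` for a.e. `s ∈ (0,T)`. [folklore] -/
theorem exists_integral_norm_sq_le
    (hE : ∃ C : ℝ≥0, ∀ᵐ t ∂(volume.restrict (Ioo 0 T)), ∫⁻ x, ‖u t x‖ₑ ^ 2 ≤ C)
    (hL2 : ∀ t ∈ Icc 0 T, MemLp (u t) 2 volume) :
    ∃ C : ℝ, 0 ≤ C ∧ ∀ᵐ s ∂(volume.restrict (Ioo 0 T)), ∫ x, ‖u s x‖ ^ 2 ≤ C := by
  obtain ⟨C, hC⟩ := hE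
  refine ⟨(C : ℝ), C.2, ?_⟩
  filter_upwards [hC, ae_restrict_mem measurableSet_Ioo] with s hs hsI
  have hmem : MemLp (u s) 2 volume := hL2 s (Ioo_subset_Icc_self hsI)
  rw [Torus.lintegral_enorm_sq_eq_ofReal hmem] at hs
  have := ENNReal.toReal_mono ENNReal.coe_ne_top hs
  rwa [ENNReal.toReal_ofReal (integral_nonneg fun x => sq_nonneg _), ENNReal.coe_toReal] at this

/-- The pairing `s ↦ ⟨u(s), a⟩` with a continuous field is integrable on `(0, T)`. [folklore] -/
theorem integrableOn_integral_inner (hw : IsWeakNSSolutionForcedOn T ν f u₀ u)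
    (hE : ∃ C : ℝ≥0, ∀ᵐ t ∂(volume.restrict (Ioo 0 T)), ∫⁻ x, ‖u t x‖ₑ ^ 2 ≤ C)
    (hL2 : ∀ t ∈ Icc 0 T, MemLp (u t) 2 volume)
    {a : UnitAddTorus d → EuclideanSpace ℝ d} (ha : Continuous a) :
    IntegrableOn (fun s => ∫ x, ⟪u s x, a x⟫) (Ioo 0 T) := by
  obtain ⟨C, -, hC⟩ := exists_integral_norm_sq_le hE hL2
  obtain ⟨K, hK0, hK⟩ := exists_nonneg_forall_norm_le_of_continuous ha
  refine ⟨aestronglyMeasurable_integral_inner hw ha, ?_⟩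
  refine HasFiniteIntegral.of_bounded (C := K * (2⁻¹ * (1 + C))) ?_
  filter_upwards [hC, ae_restrict_mem measurableSet_Ioo] with s hs hsI
  have hmem : MemLp (u s) 2 volume := hL2 s (Ioo_subset_Icc_self hsI)
  rw [Real.norm_eq_abs]
  refine (abs_integral_inner_le_of_norm_le (hmem.integrable one_le_two) hK).trans ?_
  refine mul_le_mul_of_nonneg_left ((integral_norm_le_of_memLp_two hmem).trans ?_) hK0
  gcongr

omit [DecidableEq d] in
/-- The pairing `s ↦ ⟨u(s), a⟩` with a continuous field is a.e. bounded on `(0, T)`. [folklore] -/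
theorem exists_ae_abs_integral_inner_le
    (hE : ∃ C : ℝ≥0, ∀ᵐ t ∂(volume.restrict (Ioo 0 T)), ∫⁻ x, ‖u t x‖ₑ ^ 2 ≤ C)
    (hL2 : ∀ t ∈ Icc 0 T, MemLp (u t) 2 volume)
    {a : UnitAddTorus d → EuclideanSpace ℝ d} (ha : Continuous a) :
    ∃ K : ℝ, ∀ᵐ s ∂(volume.restrict (Ioo 0 T)), |∫ x, ⟪u s x, a x⟫| ≤ K := by
  obtain ⟨C, -, hC⟩ := exists_integral_norm_sq_le hE hL2
  obtain ⟨K, hK0, hK⟩ := exists_nonneg_forall_norm_le_of_continuous ha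
  refine ⟨K * (2⁻¹ * (1 + C)), ?_⟩
  filter_upwards [hC, ae_restrict_mem measurableSet_Ioo] with s hs hsI
  have hmem : MemLp (u s) 2 volume := hL2 s (Ioo_subset_Icc_self hsI)
  refine (abs_integral_inner_le_of_norm_le (hmem.integrable one_le_two) hK).trans ?_
  refine mul_le_mul_of_nonneg_left ((integral_norm_le_of_memLp_two hmem).trans ?_) hK0
  gcongr

/-- **The flux is integrable in time** (`L¹(0,T;L²)` force): for a weak solution in the energy
class and a smooth field `Ψ`, `s ↦ ∫ (⟪u, (u·∇)Ψ⟫ + ν⟪u, ΔΨ⟫ + ⟪f, Ψ⟫)` is integrable on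
`(0, T)`. [folklore] -/
theorem integrableOn_flux_L1L2 (hw : IsWeakNSSolutionForcedOn T ν f u₀ u)
    (hE : ∃ C : ℝ≥0, ∀ᵐ t ∂(volume.restrict (Ioo 0 T)), ∫⁻ x, ‖u t x‖ₑ ^ 2 ≤ C)
    (hL2 : ∀ t ∈ Icc 0 T, MemLp (u t) 2 volume)
    (hfm : AEStronglyMeasurable (FunctionSpaces.Torus.stLift f) (volume.restrict (Ioo 0 T ×ˢ univ)))
    (hf : MemLqLp 1 2 f (Ioo 0 T))
    {Ψ : UnitAddTorus d → EuclideanSpace ℝ d} (hΨ : FunctionSpaces.Torus.IsSmooth Ψ) :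
    IntegrableOn
      (fun s => ∫ x, (⟪u s x, FunctionSpaces.Torus.convect (u s) Ψ x⟫ + ν * ⟪u s x, FunctionSpaces.Torus.laplacian Ψ x⟫ + ⟪f s x, Ψ x⟫))
      (Ioo 0 T) := by
  obtain ⟨C, hC0, hC⟩ := exists_integral_norm_sq_le hE hL2
  obtain ⟨D, hD0, hD⟩ := exists_sum_norm_partialDeriv_le hΨ
  obtain ⟨KL, hKL0, hKL⟩ := exists_nonneg_forall_norm_le_of_continuous hΨ.laplacian.continuous
  obtain ⟨KP, hKP0, hKP⟩ := exists_nonneg_forall_norm_le_of_continuous hΨ.continuous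
  obtain ⟨hfs, hNint⟩ := force_L1L2_bookkeeping hfm hf
  refine ⟨aestronglyMeasurable_flux hw hfm hΨ, ?_⟩
  -- domination by an integrable function of `s`
  have hdom : ∀ᵐ s ∂(volume.restrict (Ioo 0 T)),
      ‖∫ x, (⟪u s x, FunctionSpaces.Torus.convect (u s) Ψ x⟫ + ν * ⟪u s x, FunctionSpaces.Torus.laplacian Ψ x⟫ + ⟪f s x, Ψ x⟫)‖ ≤
        (D * C + |ν| * KL * (2⁻¹ * (1 + C))) + KP * (eLpNorm (f s) 2 volume).toReal := by
    filter_upwards [hC, hfs, ae_restrict_mem measurableSet_Ioo] with s hs hfs2 hsI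
    have hmem : MemLp (u s) 2 volume := hL2 s (Ioo_subset_Icc_self hsI)
    have i1 := integrable_inner_convect_self hmem hΨ
    have i2 : Integrable (fun x => ⟪u s x, FunctionSpaces.Torus.laplacian Ψ x⟫) volume :=
      FunctionSpaces.Torus.integrable_inner_of_continuous (hmem.integrable one_le_two) hΨ.laplacian.continuous
    have i3 : Integrable (fun x => ⟪f s x, Ψ x⟫) volume :=
      FunctionSpaces.Torus.integrable_inner_of_continuous (hfs2.integrable one_le_two) hΨ.continuous
    have i12 : Integrable (fun x => ⟪u s x, FunctionSpaces.Torus.convect (u s) Ψ x⟫ + ν * ⟪u s x, FunctionSpaces.Torus.laplacian Ψ x⟫)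
        volume := i1.add (i2.const_mul ν)
    rw [Real.norm_eq_abs, integral_add i12 i3, integral_add i1 (i2.const_mul ν),
      integral_const_mul]
    have b1 : |∫ x, ⟪u s x, FunctionSpaces.Torus.convect (u s) Ψ x⟫| ≤ D * C :=
      (abs_integral_inner_convect_self_le hmem hΨ hD).trans (by gcongr)
    have b2 : |ν * ∫ x, ⟪u s x, FunctionSpaces.Torus.laplacian Ψ x⟫| ≤ |ν| * KL * (2⁻¹ * (1 + C)) := by
      rw [abs_mul, mul_assoc]
      refine mul_le_mul_of_nonneg_left ?_ (abs_nonneg ν)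
      refine (abs_integral_inner_le_of_norm_le (hmem.integrable one_le_two) hKL).trans ?_
      refine mul_le_mul_of_nonneg_left ((integral_norm_le_of_memLp_two hmem).trans ?_) hKL0
      gcongr
    have b3 : |∫ x, ⟪f s x, Ψ x⟫| ≤ KP * (eLpNorm (f s) 2 volume).toReal :=
      (abs_integral_inner_le_of_norm_le (hfs2.integrable one_le_two) hKP).trans
        (mul_le_mul_of_nonneg_left (integral_norm_le_toReal_eLpNorm_two hfs2) hKP0)
    calc _ ≤ |∫ x, ⟪u s x, FunctionSpaces.Torus.convect (u s) Ψ x⟫| + |ν * ∫ x, ⟪u s x, FunctionSpaces.Torus.laplacian Ψ x⟫| +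
          |∫ x, ⟪f s x, Ψ x⟫| := abs_add_three _ _ _
      _ ≤ _ := by linarith
  refine HasFiniteIntegral.mono' (g := fun s =>
    (D * C + |ν| * KL * (2⁻¹ * (1 + C))) + KP * (eLpNorm (f s) 2 volume).toReal) ?_ hdom
  have : IsFiniteMeasure (volume.restrict (Ioo (0 : ℝ) T)) := ⟨by
    rw [Measure.restrict_apply_univ]; exact measure_Ioo_lt_top⟩
  exact ((integrable_const _).add (hNint.const_mul _)).hasFiniteIntegral

/-! ### Weak divergence-freeness of every positive slice and of the datum -/

/-- **Weak divergence-freeness at every positive time**: a weakly `L²`-continuous weak solution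
is weakly divergence free at *every* `t ∈ (0, T]` (the pairing `t ↦ ∫ ⟪u(t), ∇θ⟫` is continuous
on `(0, T]` and vanishes a.e.). [folklore] -/
theorem isWeaklyDivFree_of_mem_Ioc (hw : IsWeakNSSolutionForcedOn T ν f u₀ u)
    (hwc : ∀ w : UnitAddTorus d → EuclideanSpace ℝ d, MemLp w 2 volume →
      ContinuousOn (fun t => ∫ x, ⟪u t x, w x⟫) (Ioc 0 T) ∧
        Tendsto (fun t => ∫ x, ⟪u t x, w x⟫) (𝓝[>] 0) (𝓝 (∫ x, ⟪u₀ x, w x⟫)))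
    {t : ℝ} (ht : t ∈ Ioc 0 T) : FunctionSpaces.Torus.IsWeaklyDivFree (u t) := by
  intro θ hθ
  have hcont : ContinuousOn (fun s => ∫ x, ⟪u s x, FunctionSpaces.Torus.gradient θ x⟫) (Ioc 0 T) :=
    (hwc (FunctionSpaces.Torus.gradient θ) (hθ.gradient.memLp 2)).1
  have hae : ∀ᵐ s ∂(volume.restrict (Ioo 0 T)), (∫ x, ⟪u s x, FunctionSpaces.Torus.gradient θ x⟫) = 0 := by
    obtain ⟨-, -, hdiv, -⟩ := hw
    filter_upwards [hdiv] with s hs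
    exact hs θ hθ
  exact eq_zero_of_continuousOn_Ioc_of_ae_eq_zero hcont hae ht

/-- **The datum is weakly divergence free**: `∫ ⟪u₀, ∇θ⟫ = lim_{t→0⁺} ∫ ⟪u(t), ∇θ⟫ = 0`. [folklore] -/
theorem isWeaklyDivFree_datum (hw : IsWeakNSSolutionForcedOn T ν f u₀ u)
    (hwc : ∀ w : UnitAddTorus d → EuclideanSpace ℝ d, MemLp w 2 volume →
      ContinuousOn (fun t => ∫ x, ⟪u t x, w x⟫) (Ioc 0 T) ∧
        Tendsto (fun t => ∫ x, ⟪u t x, w x⟫) (𝓝[>] 0) (𝓝 (∫ x, ⟪u₀ x, w x⟫)))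
    (hT : 0 < T) : FunctionSpaces.Torus.IsWeaklyDivFree u₀ := by
  intro θ hθ
  have hw2 : MemLp (FunctionSpaces.Torus.gradient θ) 2 volume := hθ.gradient.memLp 2
  have hlim := (hwc _ hw2).2
  have hae : ∀ᵐ t ∂(volume.restrict (Ioo 0 T)), (∫ x, ⟪u t x, FunctionSpaces.Torus.gradient θ x⟫) = 0 :=
    hw.ae_isWeaklyDivFree.mono fun t ht => ht θ hθ
  exact eq_of_tendsto_nhdsGT_of_ae_eq hT hlim hae

/-! ### The time-sliced identity -/

/-- **The time-sliced weak formulation in the energy class**, `L¹(0,T;L²)` force: for a weak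
solution `u` on `T^d × [0, T)`, `T > 0`, in `L^∞(0,T;L²)` with `L²` slices and weakly
`L²`-continuous on `(0, T]`, a jointly measurable force `f ∈ L¹(0,T; L²)` and a smooth
divergence-free field `Ψ`, for **every** `t ∈ (0, T]`
`⟨u(t), Ψ⟩ = ⟨u₀, Ψ⟩ + ∫_{(0,t]} ∫ (⟪u, (u·∇)Ψ⟫ + ν ⟪u, ΔΨ⟫ + ⟪f, Ψ⟫) dx ds`
(Temam 1984, Ch. III §1.1, (1.22) ⇔ (1.25) and Lemma 1.1; same proof as the Leray–Hopf twin
`Torus.IsLerayHopfOn.integral_inner_eq_add_setIntegral_L1L2`). [cite: Temam1984, Ch. III §1.1 (1.22)–(1.25), Lemma 1.1] -/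
theorem integral_inner_eq_add_setIntegral_L1L2 (hw : IsWeakNSSolutionForcedOn T ν f u₀ u)
    (hE : ∃ C : ℝ≥0, ∀ᵐ t ∂(volume.restrict (Ioo 0 T)), ∫⁻ x, ‖u t x‖ₑ ^ 2 ≤ C)
    (hL2 : ∀ t ∈ Icc 0 T, MemLp (u t) 2 volume)
    (hwc : ∀ w : UnitAddTorus d → EuclideanSpace ℝ d, MemLp w 2 volume →
      ContinuousOn (fun t => ∫ x, ⟪u t x, w x⟫) (Ioc 0 T) ∧
        Tendsto (fun t => ∫ x, ⟪u t x, w x⟫) (𝓝[>] 0) (𝓝 (∫ x, ⟪u₀ x, w x⟫)))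
    (hT : 0 < T) (hfm : AEStronglyMeasurable (FunctionSpaces.Torus.stLift f) (volume.restrict (Ioo 0 T ×ˢ univ)))
    (hf : MemLqLp 1 2 f (Ioo 0 T))
    {Ψ : UnitAddTorus d → EuclideanSpace ℝ d} (hΨ : FunctionSpaces.Torus.IsSmooth Ψ) (hΨdiv : FunctionSpaces.Torus.IsDivFree Ψ)
    {t : ℝ} (ht : t ∈ Ioc 0 T) :
    ∫ x, ⟪u t x, Ψ x⟫ = (∫ x, ⟪u₀ x, Ψ x⟫) + ∫ s in Ioc 0 t,
      ∫ x, (⟪u s x, FunctionSpaces.Torus.convect (u s) Ψ x⟫ + ν * ⟪u s x, FunctionSpaces.Torus.laplacian Ψ x⟫ + ⟪f s x, Ψ x⟫) := by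
  have hUint := integrableOn_integral_inner hw hE hL2 hΨ.continuous
  have hFint := integrableOn_flux_L1L2 hw hE hL2 hfm hf hΨ
  have hUcont : ContinuousOn (fun s => ∫ x, ⟪u s x, Ψ x⟫) (Ioc 0 T) :=
    (hwc Ψ (hΨ.memLp 2)).1
  have hfL1 : ∀ᵐ s ∂(volume.restrict (Ioo 0 T)), Integrable (f s) volume := ae_integrable_force_slice' hf
  have hid : ∀ η : ℝ → ℝ, ContDiff ℝ ∞ η → HasCompactSupport η → tsupport η ⊆ Iio T →
      (∫ s in Ioo 0 T, (deriv η s * (∫ x, ⟪u s x, Ψ x⟫) +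
        η s * ∫ x, (⟪u s x, FunctionSpaces.Torus.convect (u s) Ψ x⟫ + ν * ⟪u s x, FunctionSpaces.Torus.laplacian Ψ x⟫ + ⟪f s x, Ψ x⟫))) +
        η 0 * (∫ x, ⟪u₀ x, Ψ x⟫) = 0 := fun η hη hηc hηT =>
    hw.test_smul (fun s hs => hL2 s (Ioo_subset_Icc_self hs)) hfL1 hΨ hΨdiv hη hηc hηT
  have hIoo : ∀ t ∈ Ioo 0 T, ∫ x, ⟪u t x, Ψ x⟫ = (∫ x, ⟪u₀ x, Ψ x⟫) + ∫ s in Ioc 0 t,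
      ∫ x, (⟪u s x, FunctionSpaces.Torus.convect (u s) Ψ x⟫ + ν * ⟪u s x, FunctionSpaces.Torus.laplacian Ψ x⟫ + ⟪f s x, Ψ x⟫) :=
    fun t ht => FunctionSpaces.eq_add_setIntegral_of_forall_test hUint hFint (hUcont.mono Ioo_subset_Ioc_self)
      hid ht
  rcases lt_or_eq_of_le ht.2 with htT | rfl
  · exact hIoo t ⟨ht.1, htT⟩
  · -- the endpoint: both sides are limits from the left within `(0, T)`
    haveI : (𝓝[Ioo 0 t] t).NeBot := by
      refine mem_closure_iff_nhdsWithin_neBot.1 ?_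
      rw [closure_Ioo hT.ne]
      exact right_mem_Icc.2 hT.le
    set Fl : ℝ → ℝ := fun s =>
      ∫ x, (⟪u s x, FunctionSpaces.Torus.convect (u s) Ψ x⟫ + ν * ⟪u s x, FunctionSpaces.Torus.laplacian Ψ x⟫ + ⟪f s x, Ψ x⟫)
    have h1 : Tendsto (fun s => ∫ x, ⟪u s x, Ψ x⟫) (𝓝[Ioo 0 t] t) (𝓝 (∫ x, ⟪u t x, Ψ x⟫)) :=
      (hUcont t ⟨hT, le_rfl⟩).mono Ioo_subset_Ioc_self
    have hFint' : IntegrableOn Fl (Icc 0 t) :=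
      (integrableOn_Icc_iff_integrableOn_Ioo (by simp) (by simp)).2 hFint
    have h2 : Tendsto (fun τ => (∫ x, ⟪u₀ x, Ψ x⟫) + ∫ s in Ioc 0 τ, Fl s) (𝓝[Ioo 0 t] t)
        (𝓝 ((∫ x, ⟪u₀ x, Ψ x⟫) + ∫ s in Ioc 0 t, Fl s)) := by
      have hprim : ContinuousWithinAt (fun τ => ∫ s in Ioc 0 τ, Fl s) (Ioo 0 t) t :=
        (intervalIntegral.continuousOn_primitive hFint' t (right_mem_Icc.2 hT.le)).mono
          Ioo_subset_Icc_self
      exact tendsto_const_nhds.add hprim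
    have heq : (fun s => ∫ x, ⟪u s x, Ψ x⟫) =ᶠ[𝓝[Ioo 0 t] t]
        fun τ => (∫ x, ⟪u₀ x, Ψ x⟫) + ∫ s in Ioc 0 τ, Fl s :=
      eventually_mem_nhdsWithin.mono fun τ hτ => hIoo τ hτ
    exact tendsto_nhds_unique (h1.congr' heq) h2

end WeakNSEnergyClass

end Torus

end Literature.Analysis.FluidPDE

end
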